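import Summits.AnomalousDissipation.AnomalousDissipation.Theorems.FloorCertificate.Negative.Uniform
import Literature.Analysis.FluidPDE.EnergySpaceRellich
import Literature.Analysis.FluidPDE.CylindricalGenerator
import Mathlib.MeasureTheory.Measure.Prokhorov

/-!
# Line `floor-minimax-dissipation-tightness` for crux `TaylorCertificates.FloorCertificate` (stmt-AnomalousDissipation-14091)

planner-cruxplan-stmt-AnomalousDissipation-14091-floor-minimax-dissip-0 · crux-plan (opening, round 1) ·
2026-08-16. Idea card `Cruxes/FloorCertificate/Ideas/floor-minimax-dissipation-tightness.md` (ideator 3;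
triage r1-1 / r1-2 / r1-3: pass ×3, named CARRIER of the merge `dissipation-deficit-duality ≈
dissipation-tight-minimax ≈ floor-minimax-dissipation-tightness`). Line card:
`Lines/floor-minimax-dissipation-tightness.md`. Sibling skeletons of the same crux (read, not imported):
`Lines/dissipation-deficit-duality.lean` (Fan + slope-bounded alternative + penalisation limit),
`Lines/marchioro-force-floor.lean` (one monolithic minimax stub + force `f_K`).

## The line in one paragraph — DISSIPATION IS ITS OWN TIGHTNESS

At fixed `ν > 0` read the crux on a ball `B_ρ = {u ∈ H : |u|² ≤ ρ}` as a game between CERTIFICATES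
`y = (Φ, θ)` (`Φ` cylindrical, `θ ≤ 0`) and RELAXED STATIONARY STATISTICS — Borel probability measures
`μ` on `H` carried by the ball with finite mean enstrophy — with payoff the mean Lagrangian
`∫ L_y dμ`, `L_y(u) = D + ⟨F_ν(u),Φ'(u)⟩ + 2θ((u,f) − D)`, `D = ν‖∇u‖²` (verbatim the crux's right-hand
side). The payoff is affine in both variables, lower semicontinuous in `μ` (narrow topology: the
generator pairing and the work are norm-continuous and bounded ON THE BALL — tree
`continuous_nsGeneratorPairing_grad`, `exists_abs_nsGeneratorPairing_grad_le` —, `D` is lsc — tree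
`lowerSemicontinuous_eGradNormSq_coe`), and at the ONE certificate `y₀ = (0, 0)` it is INF-COMPACT:
`{μ : ∫ L_{y₀} dμ ≤ c} = {μ : ν∫‖∇u‖²dμ ≤ c}` is narrowly compact because dissipation sublevel sets are
tight (Markov + Rellich, tree `isCompact_setOf_eGradNormSq_le`) and closed (S1). A LOPSIDED minimax
theorem — Ky Fan's convex-like minimax (S2) upgraded by a finite-intersection argument from "`X`
compact" to "one sublevel family of `φ(·, y₀)` compact" (S3; Aubin, Optima and Equilibria, Thm 8.1 /
Prop 8.3) — then exchanges `sup_y` and `inf_μ` with NO GAP and no slope bounds, no penalisation, no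
approximate statistics: `sup_{Φ,θ} inf_u L = min_μ sup_{Φ,θ} ∫L dμ`. Convexity of the certificate class
ON THE BALL (sums and real multiples of cylindrical functionals are realised by one `CylindricalTest`
after a `C¹_c` re-cut-off, S4) makes the right-hand `sup` equal to `ν∫‖∇u‖²dμ` on relaxed stationary
statistics and `+∞` off them, and Dirac masses at finite-enstrophy ball states evaluate the left-hand
`inf` (S5 = the instantiation). Hence (S5's conclusion `FloorMinimax`): if every relaxed stationary
statistic on `B_ρ` dissipates `≥ ε`, some `(Φ, θ ≤ 0)` certifies the floor `ε − δ` pointwise, for every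
`δ > 0`. The crux follows from ONE physics statement in dual form (S6 `RelaxedEnsembleFloor`, OPEN: some
force all of whose relaxed stationary statistics on the Leray balls are uniformly loud as `ν → 0`) by
`FloorCertificate_of` (kernel-checked logic: answer with `ε₀/2`, `δ = ε₀/2`). EXACTNESS (no costume):
`relaxedEnsembleFloor_of_floorCertificate` (PROVED here, weak duality for the relaxed class at every
radius) — S6 is NECESSARY for the crux and, given S1–S5, equivalent to it; `fmrt_loud_of_uniformRelaxedFloor`
(PROVED) — S6 makes every FMRT stationary statistical solution of the witness force `ε₀`-loud.

Stub set (6): S1 `stub_sublevelCompact` (M) · S2 `stub_fanMinimax` (M–L; verbatim the sibling line's S2 —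
prove once) · S3 `stub_lopsided_of_fan` (M; THIS card's lever) · S4 `stub_cylindricalCombination` (M) ·
S5 `stub_floorMinimax` (L; hardest provable-now) · S6 `stub_relaxedEnsembleFloor` (OPEN; hardest).

Disproof.lean (cdisprove v2, §A–§F, read 2026-08-16T04:10Z; landed `Negative/{WeakDuality, UniformTools,
Uniform}.lean`, imported here through `Negative.Uniform`): no kill, NO `_false_without_<H>` theorem is
published, so there is no obligatory hypothesis to honour; what the file does establish is honoured as
follows. §C `floorFamily_le_ensembleDissipation` / `floorCertificate_false_of_quietStatistics`: our
`weak_duality` is its relaxed-class, every-radius form, and S1–S5 prove the CONVERSE at fixed `ν` — the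
disprover's `QuietStatistics` (for the witness force, relaxed class) is thereby NECESSARY AND SUFFICIENT
for `¬FloorCertificate`, i.e. S6 is exactly the statement a disprover must refute. §B `floor_at_rest`:
`δ₀` lies in the minimax domain `X`, so every certificate produced by S5 pushes against `f` at rest
automatically. §D `floor_at_quiet_euler_point` (the `1/ν` demand at smooth quiet Euler points): met
because the certificate class of S5 is the FULL cylindrical class with unbounded weights (no slope or
resolution bound); by the minimax a family of quiet Euler POINTS refutes nothing unless an EXACT quiet
relaxed statistic exists (`δ_v` is not Liouville: `∫⟨F_ν,Φ'⟩dδ_v = −ν‖∇v‖²` at `Φ' = v`). §E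
`not_floorCertificateUniform` (landed Negative lemma): every certificate here depends on `ν` through
`ρ = 16‖f‖²/ν²` and through S6's `ν`-dependent dual bound — no stub is an instance of the refuted
`FloorCertificateUniform`, and S5 at fixed `ν` says nothing about `ν`-uniform multipliers (their dual
would live on the union of the balls, which is not tight). Negatives index (`ledger negatives`, 4 items:
13037 ceiling pair, 2979/2984 FrustratedForces drift data, 2859 DebrisQuanta): none is a floor or a
duality statement; nothing refuted is restated.
-/

noncomputable section

set_option linter.dupNamespace false

namespace Summit.AnomalousDissipation.AnomalousDissipation.Cruxes.FloorCertificate.FloorMinimaxDissipationTightness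

open MeasureTheory Filter Topology UnitAddTorus
open scoped InnerProductSpace ENNReal
open Literature.Analysis.FunctionSpaces Literature.Analysis.FluidPDE
open Summit.AnomalousDissipation.AnomalousDissipation.Theses.TaylorCertificates
open Summit.AnomalousDissipation.AnomalousDissipation.Theorems.FloorCertificate.Negative

/-- Local notation: real vector fields on `T³`. -/
local notation "Vec3" => (UnitAddTorus (Fin 3)) → (EuclideanSpace ℝ (Fin 3))
/-- Local notation: `L²(T³; ℝ³)`. -/
local notation "L2" => (Lp (EuclideanSpace ℝ (Fin 3)) 2 (volume : Measure (UnitAddTorus (Fin 3))))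
/-- Local notation: the energy space `H` (Borel σ-algebra from `StatisticalSolution.lean`). -/
local notation "H3" => (Torus.energySpace (Fin 3))

/-! ## Vocabulary (definitional abbreviations of the crux's own terms) -/

/-- Spectral enstrophy `‖∇u‖² ∈ [0, ∞]` of a state `u ∈ H`. -/
def ens (u : H3) : ℝ≥0∞ := Torus.eGradNormSq ((u : L2) : Vec3)

/-- Viscous dissipation `D = ν‖∇u‖²` (`toReal`; junk `0` at infinite enstrophy, never used there). -/
def diss (ν : ℝ) (u : H3) : ℝ := ν * (ens u).toReal

/-- The tested generator `⟨F_ν(u), Φ'(u)⟩` of a cylindrical functional (the free multiplier's term). -/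
def gen (ν : ℝ) (f : Vec3) (Φ : Torus.CylindricalTest (Fin 3)) (u : H3) : ℝ :=
  Torus.nsGeneratorPairing ν f u (Φ.grad u)

/-- The energy input `(u, f)`. -/
def work (f : Vec3) (u : H3) : ℝ := Torus.pairing (u : L2) f

/-- Squared Leray radius `16‖f‖²/ν²` (verbatim the crux's ball). -/
def lerayRadiusSq (f : Vec3) (ν : ℝ) : ℝ := 16 * (∫ x, ‖f x‖ ^ 2) / ν ^ 2

/-- The FLOOR LAGRANGIAN `L_{Φ,θ}(u) = D + ⟨F_ν(u),Φ'(u)⟩ + 2θ((u,f) − D)` — literally the right-hand side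
of the crux. -/
def lagrangian (ν : ℝ) (f : Vec3) (Φ : Torus.CylindricalTest (Fin 3)) (θ : ℝ) (u : H3) : ℝ :=
  diss ν u + gen ν f Φ u + 2 * θ * (work f u - diss ν u)

/-- `(Φ, θ)` CERTIFIES THE FLOOR `ε` at viscosity `ν` on the ball `{|u|² ≤ ρ}`: `θ ≤ 0` and the floor
inequality holds at every finite-enstrophy state of the ball (the inner clause of the crux with the
radius as a parameter; at `ρ = 16‖f‖²/ν²` it is `Negative.FloorFamily`, see
`floorFamily_iff_exists_certifiesFloor`). -/
def CertifiesFloor (ν ρ ε : ℝ) (f : Vec3) (Φ : Torus.CylindricalTest (Fin 3)) (θ : ℝ) : Prop :=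
  θ ≤ 0 ∧ ∀ u : H3, ens u ≠ ⊤ → ‖u‖ ^ 2 ≤ ρ → ε ≤ lagrangian ν f Φ θ u

/-- The crux's floor family at `(f, ε, ν)` is a certificate on the Leray ball (definitional). -/
theorem floorFamily_iff_exists_certifiesFloor (f : Vec3) (ε ν : ℝ) :
    FloorFamily f ε ν ↔
      ∃ (Φ : Torus.CylindricalTest (Fin 3)) (θ : ℝ), CertifiesFloor ν (lerayRadiusSq f ν) ε f Φ θ :=
  Iff.rfl

/-- **RELAXED STATIONARY STATISTIC** of `NS_ν(f)` on the ball `{|u|² ≤ ρ}` — the EXACT dual object of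
the crux's certificate class: a Borel probability measure on `H` carried by the ball, of finite mean
enstrophy, annihilating every cylindrical Liouville functional (dual to the free multiplier `Φ`), with
integrable work and the ONE global mean energy inequality `ν∫‖∇u‖²dμ ≤ ∫(u,f)dμ` (dual to `θ ≤ 0`).
Strictly larger than FMRT's class at the Leray radius (`isRelaxedSSS_of_isStationary`): no shell-wise
inequalities (1.31). -/
structure IsRelaxedSSS (ν ρ : ℝ) (f : Vec3) (μ : Measure H3) : Prop where
  prob : IsProbabilityMeasure μ
  ae_ball : ∀ᵐ u ∂μ, ‖u‖ ^ 2 ≤ ρ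
  enstrophy_finite : ∫⁻ u, ens u ∂μ < ⊤
  liouville : ∀ Φ : Torus.CylindricalTest (Fin 3), Integrable (gen ν f Φ) μ ∧ ∫ u, gen ν f Φ u ∂μ = 0
  work_integrable : Integrable (work f) μ
  energy_ineq : Torus.ensembleDissipation ν μ ≤ ∫ u, work f u ∂μ

/-! ## The stub statements -/

/-- **S1 — DISSIPATION SUBLEVEL SETS OF MEASURES ARE COMPACT (dissipation is its own tightness).** For
every radius `ρ` and finite enstrophy level `c`, the probability measures on `H` carried by the ball
`{|u|² ≤ ρ}` with mean enstrophy `≤ c` form a COMPACT subset of `ProbabilityMeasure H` (topology of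
weak convergence). -/
def DissipationSublevelCompact : Prop :=
  ∀ (ρ : ℝ) (c : ℝ≥0∞), c ≠ ⊤ →
    IsCompact {μ : ProbabilityMeasure H3 |
      (∀ᵐ u ∂(μ : Measure H3), ‖u‖ ^ 2 ≤ ρ) ∧ ∫⁻ u, ens u ∂(μ : Measure H3) ≤ c}

/-- **S2 — KY FAN'S CONVEX-LIKE MINIMAX PRINCIPLE** (Fan 1953, Thm 2; `γ`-form, no topology on `Y`):
`X` compact, `φ(·, y)` lower semicontinuous, `φ` convex-like in `x` and concave-like in `y`; if every `x`
is beaten by some `y` above the level `γ`, ONE `y` beats every `x` above `γ`. (Verbatim the statement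
`FanMinimax` of the sibling line `dissipation-deficit-duality` — one proof serves both lines.) -/
def FanMinimax : Prop :=
  ∀ (X Y : Type) [TopologicalSpace X] [CompactSpace X] [Nonempty Y] (φ : X → Y → ℝ),
    (∀ y : Y, LowerSemicontinuous fun x : X => φ x y) →
    (∀ (x₁ x₂ : X) (t : ℝ), 0 ≤ t → t ≤ 1 → ∃ x₀ : X, ∀ y : Y, φ x₀ y ≤ t * φ x₁ y + (1 - t) * φ x₂ y) →
    (∀ (y₁ y₂ : Y) (t : ℝ), 0 ≤ t → t ≤ 1 → ∃ y₀ : Y, ∀ x : X, t * φ x y₁ + (1 - t) * φ x y₂ ≤ φ x y₀) →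
    ∀ γ : ℝ, (∀ x : X, ∃ y : Y, γ < φ x y) → ∃ y : Y, ∀ x : X, γ < φ x y

/-- **The LOPSIDED (inf-compact) minimax principle** — the lever of the card in abstract form: the same
exchange as `FanMinimax`, WITHOUT compactness of `X`, assuming instead that for ONE `y₀` every sublevel
set `{x : φ x y₀ ≤ c}` is compact ("inf-compactness at `y₀`"; Aubin, Optima and Equilibria (1993),
Thm 8.1 / Prop. 8.2–8.3; Aubin–Ekeland, Applied Nonlinear Analysis, Ch. 6 §2 "lopsided minimax"). -/
def LopsidedMinimax : Prop :=
  ∀ (X Y : Type) [TopologicalSpace X] [Nonempty Y] (φ : X → Y → ℝ),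
    (∀ y : Y, LowerSemicontinuous fun x : X => φ x y) →
    (∀ (x₁ x₂ : X) (t : ℝ), 0 ≤ t → t ≤ 1 → ∃ x₀ : X, ∀ y : Y, φ x₀ y ≤ t * φ x₁ y + (1 - t) * φ x₂ y) →
    (∀ (y₁ y₂ : Y) (t : ℝ), 0 ≤ t → t ≤ 1 → ∃ y₀ : Y, ∀ x : X, t * φ x y₁ + (1 - t) * φ x y₂ ≤ φ x y₀) →
    (∃ y₀ : Y, ∀ c : ℝ, IsCompact {x : X | φ x y₀ ≤ c}) →
    ∀ γ : ℝ, (∀ x : X, ∃ y : Y, γ < φ x y) → ∃ y : Y, ∀ x : X, γ < φ x y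

/-- **S4 — THE CYLINDRICAL CLASS IS A VECTOR SPACE ON EVERY BALL.** For every radius `ρ`, cylindrical
`Φ₁, Φ₂` and reals `a, b` there is ONE cylindrical test functional `Φ₀` whose differential is
`a Φ₁' + b Φ₂'` at every state of the ball `{|u|² ≤ ρ}` (as test fields on `T³`). -/
def CylindricalCombination : Prop :=
  ∀ (ρ : ℝ) (Φ₁ Φ₂ : Torus.CylindricalTest (Fin 3)) (a b : ℝ),
    ∃ Φ₀ : Torus.CylindricalTest (Fin 3), ∀ u : H3, ‖u‖ ^ 2 ≤ ρ →
      Φ₀.grad u = a • Φ₁.grad u + b • Φ₂.grad u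

/-- **STRONG DUALITY FOR FLOORS ON A BALL (the conclusion of S5).** For `ν > 0`, any radius `ρ`, level
`ε` and smooth `f`: if every relaxed stationary statistic of `NS_ν(f)` on `{|u|² ≤ ρ}` has mean
dissipation `≥ ε`, then for every margin `δ > 0` some cylindrical `Φ` and weight `θ ≤ 0` certify the floor
`ε − δ` at every finite-enstrophy state of the ball. (At `ρ = 16‖f‖²/ν²` the conclusion is the crux's
floor family, `floorFamily_iff_exists_certifiesFloor`.) -/
def FloorMinimax : Prop :=
  ∀ (ν ρ ε : ℝ) (f : Vec3), 0 < ν → Torus.IsSmooth f →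
    (∀ μ : Measure H3, IsRelaxedSSS ν ρ f μ → ε ≤ Torus.ensembleDissipation ν μ) →
    ∀ δ : ℝ, 0 < δ →
      ∃ (Φ : Torus.CylindricalTest (Fin 3)) (θ : ℝ), CertifiesFloor ν ρ (ε - δ) f Φ θ

/-- The UNIFORM RELAXED-ENSEMBLE FLOOR of a force `f` (the dual form of the crux AT `f`): below `ν₀`
every relaxed stationary statistic of `NS_ν(f)` on the Leray ball dissipates at least `ε₀` in the mean
— `liminf_{ν→0} ℓ_f(ν) > 0` for `ℓ_f(ν) = inf{ν∫‖∇u‖²dμ : μ relaxed stationary on the Leray ball}`. -/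
def UniformRelaxedFloor (f : Vec3) : Prop :=
  ∃ ε₀ ν₀ : ℝ, 0 < ε₀ ∧ 0 < ν₀ ∧ ∀ ν : ℝ, 0 < ν → ν < ν₀ →
    ∀ μ : Measure H3, IsRelaxedSSS ν (lerayRadiusSq f ν) f μ → ε₀ ≤ Torus.ensembleDissipation ν μ

/-- **THE TRANSFER TARGET `C⁺` (the statement of S6; OPEN).** Some smooth solenoidal mean-zero force has
a uniform relaxed-ensemble floor: NO QUIET RELAXED STATIONARY STATISTICS on its Leray balls as `ν → 0`.
Equivalent to the crux given S1–S5 (`relaxedEnsembleFloor_of_floorCertificate` is the PROVED converse). -/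
def RelaxedEnsembleFloor : Prop :=
  ∃ f : Vec3, Torus.IsSmooth f ∧ Torus.IsDivFree f ∧ Torus.HasZeroMean f ∧ UniformRelaxedFloor f

/-! ## The stubs S1–S6 (the only `sorry`s of the file) -/

/-- **S1 `stub_sublevelCompact`** — size M, provable now. WHY TRUE: for `c < ∞` the set is TIGHT — by
Markov `μ{‖∇u‖² > t} ≤ c/t` uniformly on the set, and `{|u|² ≤ ρ} ∩ {‖∇u‖² ≤ t}` is norm-compact in
`H` (Rellich on `T³`: tree `Torus.isCompact_setOf_eGradNormSq_le`, intersected with the closed ball);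
the tree's `Literature.Probability.Process.KrylovBogoliubov.isTightMeasureSet_of_lintegral_le` is this
step for a lintegral bound with compact sublevel sets — hence relatively compact (Prokhorov, Mathlib
`isCompact_closure_of_isTightMeasureSet`; `H` is a separable metric space with its Borel σ-algebra), and
CLOSED: "carried by the closed ball" is closed under weak limits (portmanteau for the closed set
`{|u|² ≤ ρ}`: `limsup μₙ(F) ≤ μ(F)`), and `μ ↦ ∫⁻‖∇u‖²dμ` is lower semicontinuous for the weak topology
because the integrand is lsc and `≥ 0` (`Torus.lowerSemicontinuous_eGradNormSq_coe`; on a metric space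
an lsc function bounded below is the increasing limit of bounded Lipschitz functions, and
`μ ↦ ∫⁻ g dμ` is continuous for bounded continuous `g ≥ 0` by definition of the topology on
`ProbabilityMeasure`). If `ρ < 0` the set is empty. Identical to S1 `SublevelCompact` of the sibling
line `dissipation-deficit-duality` (prove once). Leans on: `EnergySpaceRellich`, Mathlib `Prokhorov`,
`Portmanteau`, `FiniteMeasure`/`ProbabilityMeasure` API, `Torus.measurable_eGradNormSq_coe`.
[FMRT2001 Ch. IV §3 (tightness of time averages); Krylov–Bogoliubov 1937.] -/
theorem stub_sublevelCompact : DissipationSublevelCompact := by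
  sorry

/-- **S2 `stub_fanMinimax`** — size M–L, provable now (pure convex analysis; reusable: file the proof
under `Literature/Analysis/Convex/` next to the tree's finite von Neumann theorem
`Literature.Analysis.Convex.MinMax.exists_mixed_of_forall_mixed_lt`, whose separation argument it
generalises; the AtomisticToContinuum crux line `almost-invariant-duality` has a sorried consumer
`CorrectorMinimax`). WHY TRUE = Fan's proof: given `γ` with `∀ x ∃ y, φ x y > γ`, the open sets
`U_y = {x : γ < φ x y}` (lsc) cover the compact `X`, so finitely many `y₁ … yₙ` give
`maxᵢ φ(x, yᵢ) > γ` for all `x`, indeed `≥ β > γ` (an lsc function attains its minimum on a compact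
space; `X = ∅` is trivial by `Nonempty Y`); the set `E = {z ∈ ℝⁿ : ∃ x, ∀ i, φ(x,yᵢ) ≤ zᵢ}` is convex
(convex-likeness in `x`) and misses the open convex box `{z : ∀ i, zᵢ < β}`; separate
(`geometric_hahn_banach_open` in `ℝⁿ`): the functional has nonnegative weights (E is an upper set),
normalise to `λ ∈ Δₙ` with `Σλᵢ φ(x,yᵢ) ≥ β` for all `x`; concave-likeness in `y`, iterated to `n`
points by induction on `n`, gives `y₀` with `φ(x, y₀) ≥ Σλᵢ φ(x,yᵢ) ≥ β > γ` for all `x`. No Hausdorff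
assumption is used. [Fan, Proc. Nat. Acad. Sci. USA 39 (1953) 42–47, Thm 2; Sion, Pacific J. Math. 8
(1958) 171–176; König, Arch. Math. 19 (1968) 482–487.] -/
theorem stub_fanMinimax : FanMinimax := by
  sorry

/-- **S3 `stub_lopsided_of_fan`** — size M, provable now; THE CARD'S LEVER in abstract form (inf-
compactness at one point of `Y` replaces compactness of `X`). WHY TRUE (finite-intersection argument,
Aubin 1993 Prop. 8.3): WLOG `X ≠ ∅`. Suppose the conclusion fails: `∀ y ∃ x, φ x y ≤ γ`. CLAIM: some
`x̄` has `φ x̄ y ≤ γ` for EVERY `y` — contradicting the hypothesis at `x̄`. Proof of the claim: put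
`K_c := {x : φ x y₀ ≤ c}` (compact by inf-compactness, closed as `φ(·,y₀)` is lsc) and
`A_y := {x ∈ K_γ : φ x y ≤ γ}` (closed in `K_γ`). Finite-intersection property: given `y₁ … y_k`, apply
`FanMinimax` in MIRROR form to the game on the standard simplex `Δ = stdSimplex ℝ (Fin (k+1))` (a
`CompactSpace`, Mathlib `isCompact_stdSimplex`) against `X`: `ψ(λ, x) := −Σᵢ λᵢ φ(x, yᵢ)` (`i = 0 … k`,
`y₀` included) is continuous in `λ`, convex-like in `λ` (take `λ₀ = tλ₁ + (1−t)λ₂`, equality) and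
concave-like in `x` (the convex-likeness of `φ` in `x` supplies ONE `x₀` serving all `yᵢ`; weights are
`≥ 0`); for every `λ ∈ Δ` the iterated concave-likeness of `φ` in `y` gives `y_λ` with
`Σλᵢφ(x,yᵢ) ≤ φ(x,y_λ)` for all `x`, and the failing conclusion at `y_λ` gives `x` with
`Σλᵢφ(x,yᵢ) ≤ γ < γ + ε`; so Fan yields, for every `ε > 0`, ONE `x_ε` with `φ(x_ε, yᵢ) < γ + ε` for all
`i ≤ k` (vertices of `Δ`). The `x_ε`, `ε ≤ 1`, lie in the compact `K_{γ+1}`; the closed sets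
`{x ∈ K_{γ+1} : ∀ i ≤ k, φ(x,yᵢ) ≤ γ + 1/n}` are nonempty and decreasing, so their intersection contains
an `x` with `φ(x, yᵢ) ≤ γ` for `i = 0 … k`, i.e. `x ∈ ⋂ᵢ A_{yᵢ}`. Compactness of `K_γ` then gives
`x̄ ∈ ⋂_y A_y`. ∎ (Values form, for the card: `inf_X sup_Y φ = sup_Y inf_X φ` with the `inf` attained when
finite.) Leans on: S2, Mathlib `stdSimplex` (`isCompact_stdSimplex`, `convex_stdSimplex`),
`IsCompact.inter_iInter_nonempty`, `LowerSemicontinuous.isClosed_preimage`. [Aubin, Optima and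
Equilibria, GTM 140 (1993), Thm 8.1, Prop. 8.2–8.3; Aubin–Ekeland, Applied Nonlinear Analysis (1984),
Ch. 6 §2 Thm 7 (lopsided minimax).] -/
theorem stub_lopsided_of_fan : FanMinimax → LopsidedMinimax := by
  sorry

/-- **S4 `stub_cylindricalCombination`** — size M, provable now (a construction inside
`Torus.CylindricalTest`; also what the sibling line's S3 uses unproved for concave-likeness). WHY TRUE:
let `Φ₁ = (m₁, g¹, φ₁)`, `Φ₂ = (m₂, g², φ₂)`. Take `m₀ = m₁ + m₂`, test fields `g⁰ = Fin.append g¹ g²`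
(smooth, solenoidal, mean-zero componentwise), and profile
`φ₀(z) = χ(z) · (a φ₁(z_I) + b φ₂(z_II))`, `z_I` / `z_II` the first `m₁` / last `m₂` coordinates, where
`χ ∈ C¹_c(ℝ^{m₀})` (Mathlib `ContDiffBump`, or a product of one-dimensional bumps) is `≡ 1` on a
neighbourhood of the box `{|zᵢ| ≤ √ρ‖gᵢ‖_{L²}}`, which contains `coords₀ u = (coords₁ u, coords₂ u)` for
every `u` of the ball (`|(u, gᵢ)| ≤ |u| ‖gᵢ‖`, tree `Torus.abs_pairing_coe_le`). Then `φ₀` is `C¹` with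
compact support (product of a `C¹_c` function with a `C¹` function), and on the ball
`∂φ₀/∂zᵢ (coords₀ u) = a ∂ᵢφ₁(coords₁ u)` (`i < m₁`), `= b ∂ⱼφ₂(coords₂ u)` (`i = m₁ + j`), so
`Φ₀'(u) = Σᵢ ∂ᵢφ₀ g⁰ᵢ = a Φ₁'(u) + b Φ₂'(u)` pointwise on `T³` (`CylindricalTest.grad` is the finite sum
`Σᵢ ∂ᵢφ(coords u) • gᵢ`). For `ρ < 0` the ball is empty. Consequences used by S5: the certificate class
is closed under `Φ ↦ sΦ` (`b = 0`), contains a functional with `Φ' = 0` on the ball (`a = b = 0`), and is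
convex on the ball (`a = t`, `b = 1 − t`); with `Torus.nsGeneratorPairing_sum_smul` (linearity of the
tested generator in the test field) the generator term of `Φ₀` is `a·gen Φ₁ + b·gen Φ₂` on the ball.
Leans on: `Torus.CylindricalTest` (fields `m, g, φ, φ_contDiff, φ_compact`), `CylindricalTest.coords/grad`,
Mathlib `ContDiffBump`, `HasCompactSupport.mul_left`, `fderiv` of products/compositions with
`ContinuousLinearMap.fst/snd`-type coordinate projections on `EuclideanSpace`. [FMRT2001 Ch. IV §1.2
Def. 1.2 (the class of cylindrical test functionals is stable under these operations), p. 197.] -/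
theorem stub_cylindricalCombination : CylindricalCombination := by
  sorry

/-- **S5 `stub_floorMinimax`** — size L, provable now GIVEN S1, S3 (fed S2) and S4: the instantiation of
the lopsided minimax on the Leray-type ball (hardest provable-now stub; all measure-theoretic plumbing of
the line lives here). WHY TRUE: fix `ν > 0`, `ρ`, `ε`, `f`, `δ > 0`; if `ρ < 0` every `(Φ, 0)` certifies
vacuously, so let `ρ ≥ 0`. GAME: `X := {μ : ProbabilityMeasure H // μ-a.e. |u|² ≤ ρ ∧ ∫⁻‖∇u‖²dμ < ∞}`
(subspace topology), `Y := {(Φ, θ) : θ ≤ 0}` (nonempty), `φ(μ, (Φ,θ)) := ∫ L_{Φ,θ} dμ =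
(1 − 2θ)·ν(∫⁻‖∇u‖²dμ).toReal + ∫⟨F_ν,Φ'⟩dμ + 2θ∫(u,f)dμ` (all integrands integrable on `X`: the
generator term and the work are continuous on `H` — `Torus.continuous_nsGeneratorPairing_grad`,
`Torus.continuous_pairing_coe` — and bounded on the ball — `Torus.exists_abs_nsGeneratorPairing_grad_le`
gives `|⟨F,Φ'⟩| ≤ K(1+ρ)`, `|(u,f)| ≤ √ρ‖f‖` by `Torus.abs_pairing_coe_le`). HYPOTHESES OF S3: (lsc) the
enstrophy term is lsc in `μ` (lsc nonnegative integrand, `Torus.lowerSemicontinuous_eGradNormSq_coe`,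
monotone approximation by bounded continuous functions; `1 − 2θ ≥ 1`; `toReal` is harmless since the
values are finite on `X`), the two other terms are CONTINUOUS on `X` (replace each integrand `g` by its
truncation `max(−M, min(M, g))` at its bound `M` on the ball — bounded continuous, equal to `g` a.e. for
every `μ ∈ X` — and use `ProbabilityMeasure.tendsto_iff_forall_integral_tendsto` / continuity of
`μ ↦ ∫ g dμ` for bounded continuous `g`); (convex-like in `μ`) mix, `μ₀ = tμ₁ + (1−t)μ₂ ∈ X`, `φ` is
affine in `μ` (equality); (concave-like in `y`) `θ₀ = tθ₁ + (1−t)θ₂ ≤ 0` and `Φ₀` from S4 with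
`(a,b) = (t, 1−t)`: by `Torus.nsGeneratorPairing_sum_smul` the Lagrangians agree ON THE BALL,
`L_{y₀} = tL_{y₁} + (1−t)L_{y₂}`, hence `φ(μ,y₀) = tφ(μ,y₁) + (1−t)φ(μ,y₂)` for `μ ∈ X` (carried by the
ball); (inf-compact at `y₀ = (Φ_zero, 0)`, `Φ_zero` from S4 with `a = b = 0`, generator term `0`)
`{μ ∈ X : φ(μ,y₀) ≤ c} = {μ : ν(∫⁻‖∇u‖²dμ).toReal ≤ c}` is the S1-set at level `c/ν` (empty for `c < 0`),
compact in `ProbabilityMeasure H` and contained in `X`, hence compact in `X`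
(`Topology.IsInducing.isCompact_iff` for the subtype). LEVEL: `γ := ε − δ`; every `μ ∈ X` is beaten above
`γ`: if `μ` is relaxed stationary (`IsRelaxedSSS`), `φ(μ, y₀) = ν∫‖∇u‖²dμ ≥ ε > γ` by hypothesis; if
some Liouville integral `∫⟨F,Φ'⟩dμ = c ≠ 0`, the scaled functional `Φ_s` (S4, `(a,b) = (s,0)`) gives
`φ(μ,(Φ_s,0)) = ν∫‖∇u‖²dμ + s c → +∞`; if the energy inequality fails, `∫(u,f)dμ − ν∫‖∇u‖²dμ = −d < 0`,
then `φ(μ,(Φ_zero,θ)) = ν∫‖∇u‖²dμ + 2|θ|d → +∞` as `θ → −∞` (these exhaust `¬ IsRelaxedSSS` on `X`: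
probability, ball, finite enstrophy and the integrabilities hold automatically there). CONCLUSION of S3:
ONE `y = (Φ, θ)`, `θ ≤ 0`, with `φ(μ, y) > γ` for all `μ ∈ X`; evaluate at DIRAC masses `δ_u`, `u` a
finite-enstrophy state of the ball (`δ_u ∈ X`: `ae_dirac_iff` with the closed ball, `lintegral_dirac'`
with `Torus.measurable_eGradNormSq_coe`; `integral_dirac` for the three continuous/measurable
integrands): `L_{Φ,θ}(u) = φ(δ_u, y) > ε − δ`, which is `CertifiesFloor ν ρ (ε − δ) f Φ θ`. ∎
Finite-dimensional shadow (sanity): on a Galerkin truncation the statement is Tobasco–Goluskin–Doering's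
theorem (tree `TobascoGoluskinDoering2018_measureForm`). Leans on: S1, S3, S4, `CylindricalGenerator`,
`StatisticalSolutionEnergyEq` (`continuous_pairing_coe`, `abs_pairing_coe_le`), `EnergySpaceRellich`
(`lowerSemicontinuous_eGradNormSq_coe`, `measurable_eGradNormSq_coe`), Mathlib `ProbabilityMeasure`
(weak topology, `tendsto_iff_forall_integral_tendsto`), `Measure.dirac`. [arXiv:2010.06730 Thm 4.1,
Thm 6.2, Rem 6.1–6.2 (Rosa–Temam: strong duality only on H-compact K in 3-D — here compactness is
supplied by the objective); arXiv:1705.07096 (Tobasco–Goluskin–Doering, compact phase space);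
FoiasManleyRosaTemam2001 IV §1.] -/
theorem stub_floorMinimax :
    DissipationSublevelCompact → LopsidedMinimax → CylindricalCombination → FloorMinimax := by
  sorry

/-- **S6 `stub_relaxedEnsembleFloor`** — OPEN (the bet; HARDEST; the crux's entire physical content in
dual form; identical in substance to S5 of the sibling line `dissipation-deficit-duality` — prove once).
The ensemble zeroth-law FLOOR for ONE force over the relaxed class: NO QUIET RELAXED STATIONARY STATISTICS
(no quiet steady state, periodic orbit, invariant measure, generalized time average, or non-dynamical
relaxed measure) on the Leray balls of `f` as `ν → 0`. WHY IT MIGHT FAIL: for every smooth `f` there may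
be quiet invariant objects — a quiet steady branch (viscous continuation of a forced steady Euler state
`P[(v·∇)v] = f`, bounded energy; route crux #6 `SmoothEulerCoerciveForce` is the pointwise obstruction,
card `cokernel-drift-escape` K3 the continuation criterion), WARM self-sustained sheltered shears
(`|u|² ≍ ν^{-2/3}`, `D ≍ ν^{1/3}`; card `shear-sheltering-dichotomy`, its toys j009329/j009988 came back
unsupportive, and for the gravest Kolmogorov force single-line sheltering is void by Iudovich–Marchioro,
TRIAGE-r1-3 (X2)), or a quiet relaxed-but-not-FMRT measure (the relaxed class carries ONE global energy
inequality; a leaky quiet statistic refutes S6 without touching the physical ensemble floor — see the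
PROVED split `uniformRelaxedFloor_of_inputFloor_of_leakLittle` below for the exact shape of that risk).
WHY IT MIGHT HOLD / WHAT THE DUAL FORM BUYS (card, Transfer (a)–(c)): the enemy is an EXACT object —
finitely supported relaxed statistics are convex combinations of Diracs at exact finite-enstrophy steady
states (localise `φ` around one atom; consistent with the landed
`EnsembleCeiling/Negative/DiracAtoms.dirac_isStationary_iff_isSteadyWeakSolution`), so the steady half IS
crux #3's floor clause; the class is convex, narrowly closed at fixed `ν`, invariant under the isometry
group of `(T³, f)` (WLOG the quietest statistic is symmetric) and admits Choquet/ergodic decomposition;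
every cylindrical `Φ` is an exact linear constraint (first-shell budget, work identity
`‖f‖² + ∫I_f dμ = νλ∫(u,f)dμ` for eigenfield forcing — sibling S2 `stub_eigenforceWorkBound`), and a
proof for a designed `f` is a finite combination of such identities plus positivity — which, read back
through S5, IS the certificate. FORCE CANDIDATES on record (tenure's call; the stub keeps `∃ f`): the
gravest Kolmogorov force `sin(2πx₁)e₀` (sibling line `marchioro-force-floor`: every 2½-D sector laminar-
loud; closes the ITEM, not the route's X), the circularly polarised `E₁⁺` force `(sin 2πx₃, cos 2πx₃, 0)`
(this card's planner note: no `x₃`-type invariance of its own, no 2½-D cellular dodgers), or the route's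
genuinely 3-D multi-shell force. Barriers: AlexakisDoering2006 bites only 2-D/2½-D statistics at BOUNDED
`U` (gravest-shell planar parts are hyper-loud); Marchioro1986 is an ALLY of a floor; Buckmaster–Vicol /
Choffrut–Székelyhidi phantoms have infinite enstrophy (outside the class). Cheapest falsifier: one quiet
invariant object of the chosen `f` found numerically (lower-branch continuation in fixed-force units,
card falsifier (2); toy DNS j009725/j009728 queued by the ideator) kills S6 FOR THAT `f` through
`weak_duality` alone. Sources: FoiasManleyRosaTemam2001 IV–V; DoeringFoias2002; arXiv:2010.06730;
BrueDeLellis2023 Q 2.1–2.2; arXiv:1512.02570; Disproof.lean §C (`QuietStatistics` is exactly `¬` this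
for every force). -/
theorem stub_relaxedEnsembleFloor : RelaxedEnsembleFloor := by
  sorry

/-! ## The composition: `FloorCertificate` from S1–S6 (kernel-checked; no `sorry` of its own) -/

/-- **`FloorCertificate` from the six stub statements.** Feed S2 to S3 (lopsided minimax), feed S1, S3,
S4 to S5 (`FloorMinimax`); take the force `f` and `(ε₀, ν₀)` of S6 and answer the crux with
`(f, ε₀/2, ν₀)`: at `ν ∈ (0, ν₀)` every relaxed stationary statistic on the Leray ball dissipates `≥ ε₀`
(S6), so `FloorMinimax` with margin `δ = ε₀/2` hands over `(Φ, θ ≤ 0)` certifying `ε₀ − ε₀/2 = ε₀/2` at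
every finite-enstrophy state of the Leray ball — verbatim the crux's floor family. -/
theorem FloorCertificate_of :
    DissipationSublevelCompact → FanMinimax → (FanMinimax → LopsidedMinimax) → CylindricalCombination →
      (DissipationSublevelCompact → LopsidedMinimax → CylindricalCombination → FloorMinimax) →
        RelaxedEnsembleFloor → FloorCertificate := by
  intro h₁ h₂ h₃ h₄ h₅ h₆
  have hFM : FloorMinimax := h₅ h₁ (h₃ h₂) h₄
  obtain ⟨f, hfs, hfd, hfz, ε₀, ν₀, hε₀, hν₀, hC⟩ := h₆
  rw [floorCertificate_iff]
  refine ⟨f, hfs, hfd, hfz, ε₀ / 2, ν₀, half_pos hε₀, hν₀, fun ν hν hνlt => ?_⟩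
  obtain ⟨Φ, θ, hθ, hfloor⟩ :=
    hFM ν (lerayRadiusSq f ν) ε₀ f hν hfs (hC ν hν hνlt) (ε₀ / 2) (half_pos hε₀)
  refine ⟨Φ, θ, hθ, fun u => ?_⟩
  intro hfin hball
  have key : ε₀ / 2 ≤ lagrangian ν f Φ θ u := by
    have h := hfloor u hfin hball
    linarith
  exact key

/-- The same composition wired to the sorried stubs: a closed term of the crux's type modulo S1–S6. -/
theorem FloorCertificate_of_stubs : FloorCertificate :=
  FloorCertificate_of stub_sublevelCompact stub_fanMinimax stub_lopsided_of_fan stub_cylindricalCombination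
    stub_floorMinimax stub_relaxedEnsembleFloor

/-! ## Proved: weak duality at every radius, exactness, FMRT ⊂ relaxed, what S6 buys -/

/-- **WEAK DUALITY for the relaxed class at every radius (PROVED).** A certificate `(Φ, θ)` for the floor
`ε` on the ball `{|u|² ≤ ρ}` bounds the mean dissipation of EVERY relaxed stationary statistic of
`NS_ν(f)` on that ball from below: the floor holds `μ`-a.e. (finite enstrophy a.e., carried by the ball),
integrate, the Liouville identity kills the generator term, `θ ≤ 0` and the global energy inequality sign
the energy channel away. (The every-radius relaxed-class form of the landed
`Negative.floorFamily_le_ensembleDissipation`; the easy direction of the minimax.) -/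
theorem weak_duality {ν ρ ε : ℝ} {f : Vec3} {Φ : Torus.CylindricalTest (Fin 3)} {θ : ℝ}
    (hcert : CertifiesFloor ν ρ ε f Φ θ) {μ : Measure H3} (hμ : IsRelaxedSSS ν ρ f μ) :
    ε ≤ Torus.ensembleDissipation ν μ := by
  obtain ⟨hθ, hfloor⟩ := hcert
  haveI := hμ.prob
  have hGm : Measurable (ens : H3 → ℝ≥0∞) := Torus.measurable_eGradNormSq_coe
  have hGfin : ∫⁻ u, ens u ∂μ < ∞ := hμ.enstrophy_finite
  have hGlt : ∀ᵐ u ∂μ, ens u < ∞ := ae_lt_top hGm hGfin.ne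
  have hA : Integrable (fun u => (ens u).toReal) μ :=
    integrable_toReal_of_lintegral_ne_top hGm.aemeasurable hGfin.ne
  have hB : Integrable (work f) μ := hμ.work_integrable
  obtain ⟨hC, hC0⟩ := hμ.liouville Φ
  -- the FLOOR holds `μ`-a.e.
  have hae : ∀ᵐ u ∂μ, ε ≤ ν * (ens u).toReal + gen ν f Φ u +
      2 * θ * (work f u - ν * (ens u).toReal) := by
    filter_upwards [hGlt, hμ.ae_ball] with u hu hball
    exact hfloor u hu.ne hball
  -- integrate
  have h1 : Integrable (fun u : H3 => ν * (ens u).toReal) μ := hA.const_mul ν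
  have h2 : Integrable (fun u : H3 => ν * (ens u).toReal + gen ν f Φ u) μ := h1.add hC
  have h3 : Integrable (fun u : H3 => work f u - ν * (ens u).toReal) μ := hB.sub h1
  have h4 : Integrable (fun u : H3 => 2 * θ * (work f u - ν * (ens u).toReal)) μ := h3.const_mul _
  have hint : Integrable (fun u : H3 => ν * (ens u).toReal + gen ν f Φ u +
      2 * θ * (work f u - ν * (ens u).toReal)) μ := h2.add h4
  have hmono := integral_mono_ae (integrable_const ε) hint hae
  have hconst : ∫ _ : H3, ε ∂μ = ε := by simp
  have hsplit : ∫ u : H3, (ν * (ens u).toReal + gen ν f Φ u +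
      2 * θ * (work f u - ν * (ens u).toReal)) ∂μ =
      ν * (∫⁻ u, ens u ∂μ).toReal + 0 +
        2 * θ * (∫ u : H3, work f u ∂μ - ν * (∫⁻ u, ens u ∂μ).toReal) := by
    rw [integral_add h2 h4, integral_add h1 hC, integral_const_mul, integral_const_mul, integral_sub hB h1,
      integral_const_mul, hC0, integral_toReal hGm.aemeasurable hGlt]
  rw [hconst, hsplit] at hmono
  -- the global energy inequality `ν ∫‖∇u‖² ≤ ∫ (u,f)`
  have hE : ν * (∫⁻ u, ens u ∂μ).toReal ≤ ∫ u, work f u ∂μ := hμ.energy_ineq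
  have hθ' : 2 * θ * (∫ u, work f u ∂μ - ν * (∫⁻ u, ens u ∂μ).toReal) ≤ 0 :=
    mul_nonpos_of_nonpos_of_nonneg (by linarith) (by linarith)
  change ε ≤ ν * (∫⁻ u, ens u ∂μ).toReal
  linarith

/-- **EXACTNESS (PROVED): the crux implies S6.** `FloorCertificate → RelaxedEnsembleFloor` by weak
duality on the Leray balls — so S6 is NECESSARY for the crux, and with S1–S5 equivalent to it: the
transfer passes through the strong-duality theorem S1–S5 (the layer-2 item the route header lists under
NOT DECOMPOSED YET), not through rewording. -/
theorem relaxedEnsembleFloor_of_floorCertificate (h : FloorCertificate) : RelaxedEnsembleFloor := by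
  rw [floorCertificate_iff] at h
  obtain ⟨f, hfs, hfd, hfz, ε₀, ν₀, hε₀, hν₀, hcert⟩ := h
  refine ⟨f, hfs, hfd, hfz, ε₀, ν₀, hε₀, hν₀, fun ν hν hνlt μ hμ => ?_⟩
  obtain ⟨Φ, θ, hΦ⟩ := (floorFamily_iff_exists_certifiesFloor f ε₀ ν).1 (hcert ν hν hνlt)
  exact weak_duality hΦ hμ

/-- **FMRT ⊂ RELAXED (PROVED).** Every stationary statistical solution of `NS_ν(f)` (FMRT IV Def. 1.3,
`ν > 0`, `f` smooth) is a relaxed stationary statistic on the Leray ball: support bound (1.34)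
`|u| ≤ ‖f‖/(4π²ν)` ⊂ Leray ball (`ae_norm_le`, `Negative.ball_of_norm_le`), finite mean enstrophy
(1.29), the Liouville equation (1.30), and the shell inequality (1.31) at `(0, ∞)` (`energy_le_holds`).
Hence Dirac masses at steady states in `V` and generalized time-average measures of Leray–Hopf flows are
relaxed statistics (tree `isStationaryStatisticalSolution_dirac_holds`, `timeAverage_isStationary_holds`). -/
theorem isRelaxedSSS_of_isStationary {ν : ℝ} (hν : 0 < ν) {f : Vec3} (hfs : Torus.IsSmooth f)
    {μ : Measure H3} (hμ : Torus.IsStationaryStatisticalSolution ν f μ) :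
    IsRelaxedSSS ν (lerayRadiusSq f ν) f μ := by
  have hf : MemLp f 2 volume := hfs.memLp 2
  refine ⟨hμ.prob, ?_, hμ.enstrophy_finite, hμ.generator, hμ.integrable_pairing hf, ?_⟩
  · filter_upwards [hμ.ae_norm_le hν hf] with u hu
    exact ball_of_norm_le hν hf hu
  · exact Torus.IsStationaryStatisticalSolution.energy_le_holds hμ hf

/-- **What S6 buys physically (PROVED): the ensemble zeroth-law floor over FMRT statistics.** Under a
uniform relaxed floor every stationary statistical solution of `NS_ν(f)`, `ν < ν₀`, dissipates at least
`ε₀` — the "dual reading" in the crux's docstring, and the exact negation lane of the disprover's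
`QuietStatistics` (Disproof.lean §C) for the witness force. -/
theorem fmrt_loud_of_uniformRelaxedFloor {f : Vec3} (hfs : Torus.IsSmooth f) (h : UniformRelaxedFloor f) :
    ∃ ε₀ ν₀ : ℝ, 0 < ε₀ ∧ 0 < ν₀ ∧ ∀ ν : ℝ, 0 < ν → ν < ν₀ → ∀ μ : Measure H3,
      Torus.IsStationaryStatisticalSolution ν f μ → ε₀ ≤ Torus.ensembleDissipation ν μ := by
  obtain ⟨ε₀, ν₀, hε₀, hν₀, h⟩ := h
  exact ⟨ε₀, ν₀, hε₀, hν₀, fun ν hν hνlt μ hμ => h ν hν hνlt μ (isRelaxedSSS_of_isStationary hν hfs hμ)⟩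

/-! ## Proved glue offered to the lead: the INPUT/LEAK split of S6 (card's planner note, not a stub)

The certificate's energy channel `θ ≤ 0` cannot price a LEAK `∫(u,f)dμ − ν∫‖∇u‖²dμ > 0` (weak duality
gives `ε ≤ ε(μ) + 2θ·leak ≤ ε(μ)`), so S6 is exactly the conjunction of the physically believed INPUT
floor and the regularity-flavoured statement that QUIET statistics leak little. Both directions of the
easy half are proved; the lead may cut S6 here (cf. the sibling `marchioro-force-floor` S3/S4, pinned). -/

/-- INPUT FLOOR of `f`: every relaxed stationary statistic on the Leray ball injects at least `ε₀`,
`∫(u,f)dμ ≥ ε₀`, uniformly in `ν < ν₀` (the ensemble zeroth law in its physical form: the mean power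
input does not vanish with the viscosity). -/
def RelaxedInputFloor (f : Vec3) : Prop :=
  ∃ ε₀ ν₀ : ℝ, 0 < ε₀ ∧ 0 < ν₀ ∧ ∀ ν : ℝ, 0 < ν → ν < ν₀ →
    ∀ μ : Measure H3, IsRelaxedSSS ν (lerayRadiusSq f ν) f μ → ε₀ ≤ ∫ u, work f u ∂μ

/-- QUIET STATISTICS LEAK LITTLE for `f`: for every tolerance `η > 0`, below some dissipation level `ε₂`
and viscosity `ν₂`, a relaxed stationary statistic with `ε(μ) < ε₂` has leak `∫(u,f)dμ − ε(μ) ≤ η`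
(stationary-ensemble shadow of the energy EQUALITY at positive viscosity; zero leak holds for every
finitely supported relaxed statistic by Temam's `IsSteadyWeakSolution.energy_eq'`). -/
def QuietStatisticsLeakLittle (f : Vec3) : Prop :=
  ∀ η : ℝ, 0 < η → ∃ ε₂ ν₂ : ℝ, 0 < ε₂ ∧ 0 < ν₂ ∧ ∀ ν : ℝ, 0 < ν → ν < ν₂ →
    ∀ μ : Measure H3, IsRelaxedSSS ν (lerayRadiusSq f ν) f μ → Torus.ensembleDissipation ν μ < ε₂ →
      ∫ u, work f u ∂μ ≤ Torus.ensembleDissipation ν μ + η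

/-- The input floor is NECESSARY for S6 at `f` (energy inequality). -/
theorem inputFloor_of_uniformRelaxedFloor {f : Vec3} (h : UniformRelaxedFloor f) : RelaxedInputFloor f := by
  obtain ⟨ε₀, ν₀, hε₀, hν₀, h⟩ := h
  exact ⟨ε₀, ν₀, hε₀, hν₀, fun ν hν hνlt μ hμ => (h ν hν hνlt μ hμ).trans hμ.energy_ineq⟩

/-- **INPUT FLOOR + SMALL LEAK ⇒ S6 at `f` (PROVED glue).** With `η = ε₀/2`: a statistic dissipating
`< ε₂` injects `≤ ε(μ) + ε₀/2` yet `≥ ε₀`, so `ε(μ) ≥ ε₀/2`; otherwise `ε(μ) ≥ ε₂`. -/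
theorem uniformRelaxedFloor_of_inputFloor_of_leakLittle {f : Vec3} (hI : RelaxedInputFloor f)
    (hL : QuietStatisticsLeakLittle f) : UniformRelaxedFloor f := by
  obtain ⟨ε₀, ν₀, hε₀, hν₀, hI⟩ := hI
  obtain ⟨ε₂, ν₂, hε₂, hν₂, hL⟩ := hL (ε₀ / 2) (half_pos hε₀)
  refine ⟨min ε₂ (ε₀ / 2), min ν₀ ν₂, lt_min hε₂ (half_pos hε₀), lt_min hν₀ hν₂,
    fun ν hν hνlt μ hμ => ?_⟩
  have hν₀' : ν < ν₀ := lt_of_lt_of_le hνlt (min_le_left _ _)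
  have hν₂' : ν < ν₂ := lt_of_lt_of_le hνlt (min_le_right _ _)
  by_cases hq : Torus.ensembleDissipation ν μ < ε₂
  · have h1 := hI ν hν hν₀' μ hμ
    have h2 := hL ν hν hν₂' μ hμ hq
    exact (min_le_right _ _).trans (by linarith)
  · exact (min_le_left _ _).trans (not_lt.1 hq)

/-- The pinned-force shape of the line (for a lead who fixes the witness, e.g. per the sibling line
`marchioro-force-floor` or the card's `E₁⁺` note): a uniform relaxed floor for ONE admissible force
already gives S6. -/
theorem relaxedEnsembleFloor_of_pinned {f : Vec3} (hfs : Torus.IsSmooth f) (hfd : Torus.IsDivFree f)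
    (hfz : Torus.HasZeroMean f) (h : UniformRelaxedFloor f) : RelaxedEnsembleFloor :=
  ⟨f, hfs, hfd, hfz, h⟩

end Summit.AnomalousDissipation.AnomalousDissipation.Cruxes.FloorCertificate.FloorMinimaxDissipationTightness

end
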